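import Literature.Geometry.Kaehler.ComplexTorusPolarizationAdditionDegree
import Literature.Geometry.Kaehler.ComplexTorusThetaPullback
import HarnessLib

/-!
# Debarre 1996, Théorème 3 and Corollaire 4 for `h⁰` itself (un-squared)

Layer `Literature/Geometry/Kaehler`, namespace `Literature.Geometry.Kaehler.ComplexTorus`; lane `lit-hodgefound`
(Track 2 foundations library), seat p16, row g14-#3 FILE 3 (rider). THEOREMS ONLY: no definition, no named fact,
net debt `0`.

Row g14-#3 FILES 1–2 (`ComplexTorusPolarizationProductInequality`, `ComplexTorusPolarizationAdditionDegree`)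
prove Debarre's Théorème 3 / Corollaire 4 SQUARED, for `polarizationDegree = det E = h⁰(L)²`. This rider takes
the square root with the tree's **`IsRiemannForm.sq_h0_lineBundleAH_eq_polarizationDegree`**
(`h⁰(X, L(H, χ))² = polarizationDegree (X, Im H)`, Lange 2023 Thm 1.5.9 / Cor. 1.7.2) and states both results
for `h⁰ = (lineBundleAH _ _).h0` of the line bundles `L(H, χ)`, `χ` any semicharacter, VERBATIM:

* O. Debarre, C. R. Acad. Sci. Paris **323** (1996), § 2 **Théorème 3** (`r = 2`): «Soit `L` un fibré en droites
  ample sur une variété abélienne produit `X = X₁ × X₂`. On a `h⁰(X, L) ≤ h⁰(X₁, L|X₁) h⁰(X₂, L|X₂)`. Pour qu'il y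
  ait égalité, il faut et il suffit que `L` soit isomorphe à `L|X₁ ⊠ L|X₂`» — **`debarre1996_theoreme_3_h0`**,
  **`debarre1996_theoreme_3_h0_eq_iff`** (equality iff `Im H` is the product form `ω|X₁ ⊞ ω|X₂`; the
  semicharacters do not enter `h⁰`);
* **Corollaire 4**: «Soient `X` une variété abélienne, et `X₁` et `X₂` des sous-variétés abéliennes de `X`. Si
  `L` est un fibré en droites ample sur `X`, on a `(X₁·X₂) h⁰(X, L) ≤ h⁰(X₁, L|X₁) h⁰(X₂, L|X₂)`» for
  complementary `X₁`, `X₂` (`Λ ⊗ ℝ = V ⊕ W`, `X₁·X₂ = #(X₁ ∩ X₂)` the degree of the addition isogeny) —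
  **`debarre1996_corollaire_4_h0`**, `debarre1996_corollaire_4_h0_eq_iff`.
-- TODO(general form): `X₁·X₂ = 0` (non-complementary dimensions, the trivial case of the printed corollary)
-- and `r > 2` factors are not restated.

## References

* [Debarre1996PolarisationsProduits] O. Debarre, C. R. Acad. Sci. Paris Sér. I **323** (1996) 631–635, § 2
  Théorème 3 and Corollaire 4 (`paper:url-cf01ad14f74f` pp. 3–4).
* [Lange2023AbelianVarietiesComplex] H. Lange, *Abelian Varieties over the Complex Numbers*, Springer 2023,
  §1.5.3 Thm. 1.5.9 (`h⁰(L) = Pf(E)`), §1.7.1 Cor. 1.7.2.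
-/

noncomputable section

open Module Function Submodule Complex Set Matrix

namespace Literature.Geometry.Kaehler

namespace ComplexTorus

/-- `a² ≤ b²` in `ℝ` for naturals gives `a ≤ b`. [folklore] -/
private theorem natCast_le_of_sq_le {a b : ℕ} (h : (a : ℝ) ^ 2 ≤ (b : ℝ) ^ 2) : a ≤ b := by
  have := (pow_le_pow_iff_left₀ (Nat.cast_nonneg a) (Nat.cast_nonneg b) two_ne_zero).1 h
  exact_mod_cast this

/-- `a² = b²` in `ℝ` for naturals iff `a = b`. [folklore] -/
private theorem natCast_sq_eq_sq_iff {a b : ℕ} : (a : ℝ) ^ 2 = (b : ℝ) ^ 2 ↔ a = b := by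
  rw [pow_left_inj₀ (Nat.cast_nonneg a) (Nat.cast_nonneg b) two_ne_zero, Nat.cast_inj]

/-! ### § 1 Corollaire 4 for `h⁰` -/

section Corollaire4

variable {ι : Type*} {E : Type*} [NormedAddCommGroup E] [NormedSpace ℂ E] [Fintype ι] [DecidableEq ι]
  {Φ : (ι → ℝ) ≃L[ℝ] E} {η : E [⋀^Fin 2]→L[ℝ] ℝ} {V W : Submodule ℝ (ι → ℝ)}

/-- **Debarre 1996, Corollaire 4: «`(X₁·X₂) h⁰(X, L) ≤ h⁰(X₁, L|X₁) h⁰(X₂, L|X₂)`»** for complementary abelian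
subvarieties `X₁`, `X₂` (`Λ ⊗ ℝ = V ⊕ W`) of `X`, the line bundles `L = L(H, χ)`, `L|Xᵢ = L(H|Xᵢ, χᵢ)` of the
polarisation `η = Im H` and of its restrictions (any semicharacters), and `X₁·X₂ = #(X₁ ∩ X₂)` the degree of the
addition isogeny `σ : X₁ × X₂ → X`. [cite: Debarre1996PolarisationsProduits, Corollaire 4]
[cite: Lange2023AbelianVarietiesComplex, §1.5.3 Thm. 1.5.9 (`h⁰(L) = Pf(E)`)] -/
theorem debarre1996_corollaire_4_h0 (hη : IsRiemannForm Φ η) (hV : IsLatticeSubspace V)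
    (hVc : IsComplexSubspace Φ V) (hW : IsLatticeSubspace W) (hWc : IsComplexSubspace Φ W) (hVW : IsCompl V W)
    {χ : (ι → ℤ) → ℂ} (hχ : IsSemicharacter Φ η χ)
    {χ₁ : (Fin (subRank V) → ℤ) → ℂ}
    (hχ₁ : IsSemicharacter (subtorusPeriod Φ V hV hVc) (pullbackForm (cxSpan Φ V).subtypeL η) χ₁)
    {χ₂ : (Fin (subRank W) → ℤ) → ℂ}
    (hχ₂ : IsSemicharacter (subtorusPeriod Φ W hW hWc) (pullbackForm (cxSpan Φ W).subtypeL η) χ₂) :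
    Nat.card ↥(subtorus Φ V ⊓ subtorus Φ W) * (lineBundleAH hη.isNSForm hχ).h0 ≤
      (lineBundleAH (isRiemannForm_restrict Φ hη hV hVc).isNSForm hχ₁).h0 *
        (lineBundleAH (isRiemannForm_restrict Φ hη hW hWc).isNSForm hχ₂).h0 := by
  apply natCast_le_of_sq_le
  push_cast
  rw [mul_pow, mul_pow, hη.sq_h0_lineBundleAH_eq_polarizationDegree hχ,
    (isRiemannForm_restrict Φ hη hV hVc).sq_h0_lineBundleAH_eq_polarizationDegree hχ₁,
    (isRiemannForm_restrict Φ hη hW hWc).sq_h0_lineBundleAH_eq_polarizationDegree hχ₂]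
  exact debarre1996_corollaire_4 hη hV hVc hW hWc hVW

/-- **Corollaire 4 for `h⁰`, the equality case**: `(X₁·X₂) h⁰(X, L) = h⁰(X₁, L|X₁) h⁰(X₂, L|X₂)` iff
`η(ΦV, ΦW) = 0`. [cite: Debarre1996PolarisationsProduits, Théorème 3 and Corollaire 4] -/
theorem debarre1996_corollaire_4_h0_eq_iff (hη : IsRiemannForm Φ η) (hV : IsLatticeSubspace V)
    (hVc : IsComplexSubspace Φ V) (hW : IsLatticeSubspace W) (hWc : IsComplexSubspace Φ W) (hVW : IsCompl V W)
    {χ : (ι → ℤ) → ℂ} (hχ : IsSemicharacter Φ η χ)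
    {χ₁ : (Fin (subRank V) → ℤ) → ℂ}
    (hχ₁ : IsSemicharacter (subtorusPeriod Φ V hV hVc) (pullbackForm (cxSpan Φ V).subtypeL η) χ₁)
    {χ₂ : (Fin (subRank W) → ℤ) → ℂ}
    (hχ₂ : IsSemicharacter (subtorusPeriod Φ W hW hWc) (pullbackForm (cxSpan Φ W).subtypeL η) χ₂) :
    Nat.card ↥(subtorus Φ V ⊓ subtorus Φ W) * (lineBundleAH hη.isNSForm hχ).h0 =
      (lineBundleAH (isRiemannForm_restrict Φ hη hV hVc).isNSForm hχ₁).h0 *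
        (lineBundleAH (isRiemannForm_restrict Φ hη hW hWc).isNSForm hχ₂).h0 ↔
      ∀ v ∈ V, ∀ w ∈ W, η ![Φ v, Φ w] = 0 := by
  rw [← debarre1996_corollaire_4_eq_iff hη hV hVc hW hWc hVW, ← natCast_sq_eq_sq_iff]
  push_cast
  rw [mul_pow, mul_pow, hη.sq_h0_lineBundleAH_eq_polarizationDegree hχ,
    (isRiemannForm_restrict Φ hη hV hVc).sq_h0_lineBundleAH_eq_polarizationDegree hχ₁,
    (isRiemannForm_restrict Φ hη hW hWc).sq_h0_lineBundleAH_eq_polarizationDegree hχ₂]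

end Corollaire4

/-! ### § 2 Théorème 3 for `h⁰` on a product torus -/

section Theoreme3

variable {ι₁ ι₂ : Type*} [Fintype ι₁] [Fintype ι₂] [DecidableEq ι₁] [DecidableEq ι₂]
  {E₁ E₂ : Type*} [NormedAddCommGroup E₁] [NormedSpace ℂ E₁] [NormedAddCommGroup E₂] [NormedSpace ℂ E₂]
  (Φ₁ : (ι₁ → ℝ) ≃L[ℝ] E₁) (Φ₂ : (ι₂ → ℝ) ≃L[ℝ] E₂)

omit [DecidableEq ι₂] in
/-- `Φ([1; 0] x) = (Φ₁ x, 0)`: the rational representation `[1; 0]` of the inclusion `X₁ × 0 ⊆ X₁ × X₂`.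
[cite: Lange2023AbelianVarietiesComplex, §2.4.4 Cor. 2.4.24, p. 123] -/
private theorem prodPeriod_fromRows_one_zero_mulVec (x : ι₁ → ℝ) :
    prodPeriod Φ₁ Φ₂ (((fromRows (1 : Matrix ι₁ ι₁ ℤ) (0 : Matrix ι₂ ι₁ ℤ)).map (Int.cast : ℤ → ℝ)) *ᵥ x) =
      ContinuousLinearMap.inl ℂ E₁ E₂ (Φ₁ x) := by
  rw [fromRows_map, Matrix.map_one _ Int.cast_zero Int.cast_one, Matrix.map_zero _ Int.cast_zero, fromRows_mulVec,
    one_mulVec, zero_mulVec, prodPeriod_apply, ContinuousLinearMap.inl_apply, Prod.mk.injEq]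
  exact ⟨rfl, map_zero Φ₂⟩

omit [DecidableEq ι₁] in
/-- `Φ([0; 1] y) = (0, Φ₂ y)`: the rational representation `[0; 1]` of the inclusion `0 × X₂ ⊆ X₁ × X₂`.
[cite: Lange2023AbelianVarietiesComplex, §2.4.4 Cor. 2.4.24, p. 123] -/
private theorem prodPeriod_fromRows_zero_one_mulVec (y : ι₂ → ℝ) :
    prodPeriod Φ₁ Φ₂ (((fromRows (0 : Matrix ι₁ ι₂ ℤ) (1 : Matrix ι₂ ι₂ ℤ)).map (Int.cast : ℤ → ℝ)) *ᵥ y) =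
      ContinuousLinearMap.inr ℂ E₁ E₂ (Φ₂ y) := by
  rw [fromRows_map, Matrix.map_one _ Int.cast_zero Int.cast_one, Matrix.map_zero _ Int.cast_zero, fromRows_mulVec,
    one_mulVec, zero_mulVec, prodPeriod_apply, ContinuousLinearMap.inr_apply, Prod.mk.injEq]
  exact ⟨map_zero Φ₁, rfl⟩

variable {Φ₁ Φ₂} {ω : (E₁ × E₂) [⋀^Fin 2]→L[ℝ] ℝ}

omit [DecidableEq ι₂] in
/-- **The restriction `ω|X₁×0` of a polarisation of `X₁ × X₂` is a polarisation of `X₁`** (`L|X₁` is ample).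
[cite: Debarre1996PolarisationsProduits, Théorème 3 («`L|X₁`»)] [cite: Lange2023AbelianVarietiesComplex, §2.1.1 Prop. 2.1.1 (a)] -/
theorem IsRiemannForm.pullbackForm_inl (hω : IsRiemannForm (prodPeriod Φ₁ Φ₂) ω) :
    IsRiemannForm Φ₁ (pullbackForm (ContinuousLinearMap.inl ℂ E₁ E₂) ω) :=
  hω.pullback Φ₁ (prodPeriod Φ₁ Φ₂) (prodPeriod_fromRows_one_zero_mulVec Φ₁ Φ₂)
    fun x y h ↦ by simpa using congrArg Prod.fst h

omit [DecidableEq ι₁] in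
/-- **The restriction `ω|0×X₂` of a polarisation of `X₁ × X₂` is a polarisation of `X₂`.**
[cite: Debarre1996PolarisationsProduits, Théorème 3 («`L|X₂`»)] [cite: Lange2023AbelianVarietiesComplex, §2.1.1 Prop. 2.1.1 (a)] -/
theorem IsRiemannForm.pullbackForm_inr (hω : IsRiemannForm (prodPeriod Φ₁ Φ₂) ω) :
    IsRiemannForm Φ₂ (pullbackForm (ContinuousLinearMap.inr ℂ E₁ E₂) ω) :=
  hω.pullback Φ₂ (prodPeriod Φ₁ Φ₂) (prodPeriod_fromRows_zero_one_mulVec Φ₁ Φ₂)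
    fun x y h ↦ by simpa using congrArg Prod.snd h

/-- **Debarre 1996, Théorème 3 (`r = 2`), VERBATIM for `h⁰`: «Soit `L` un fibré en droites ample sur une variété
abélienne produit `X = X₁ × X₂`. On a `h⁰(X, L) ≤ h⁰(X₁, L|X₁) h⁰(X₂, L|X₂)`»** — for `L = L(H, χ)` with
`ω = Im H` ANY polarisation of the product torus `X₁ × X₂` and `L|X₁ = L(H|X₁, χ₁)`, `L|X₂ = L(H|X₂, χ₂)`
(any semicharacters; `h⁰` does not depend on them). Proof: Fischer's inequality (row g14-#3 FILE 1), not
Kempf's index theorem. [cite: Debarre1996PolarisationsProduits, Théorème 3]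
[cite: Lange2023AbelianVarietiesComplex, §1.5.3 Thm. 1.5.9 (`h⁰(L) = Pf(E)`)] -/
theorem debarre1996_theoreme_3_h0 (hω : IsRiemannForm (prodPeriod Φ₁ Φ₂) ω)
    {χ : (ι₁ ⊕ ι₂ → ℤ) → ℂ} (hχ : IsSemicharacter (prodPeriod Φ₁ Φ₂) ω χ)
    {χ₁ : (ι₁ → ℤ) → ℂ} (hχ₁ : IsSemicharacter Φ₁ (pullbackForm (ContinuousLinearMap.inl ℂ E₁ E₂) ω) χ₁)
    {χ₂ : (ι₂ → ℤ) → ℂ} (hχ₂ : IsSemicharacter Φ₂ (pullbackForm (ContinuousLinearMap.inr ℂ E₁ E₂) ω) χ₂) :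
    (lineBundleAH hω.isNSForm hχ).h0 ≤
      (lineBundleAH hω.pullbackForm_inl.isNSForm hχ₁).h0 * (lineBundleAH hω.pullbackForm_inr.isNSForm hχ₂).h0 := by
  apply natCast_le_of_sq_le
  push_cast
  rw [mul_pow, hω.sq_h0_lineBundleAH_eq_polarizationDegree hχ,
    hω.pullbackForm_inl.sq_h0_lineBundleAH_eq_polarizationDegree hχ₁,
    hω.pullbackForm_inr.sq_h0_lineBundleAH_eq_polarizationDegree hχ₂]
  exact debarre1996_theoreme_3_prod hω

/-- **Théorème 3 for `h⁰`, the equality case: «Pour qu'il y ait égalité, il faut et il suffit que `L` soit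
isomorphe à `L|X₁ ⊠ L|X₂`»** — `h⁰(X, L) = h⁰(X₁, L|X₁) h⁰(X₂, L|X₂)` iff `Im H` is the product form
`ω|X₁ ⊞ ω|X₂` (`prodForm`), i.e. iff `H` — equivalently the polarisation `L` up to translation — splits.
[cite: Debarre1996PolarisationsProduits, Théorème 3] -/
theorem debarre1996_theoreme_3_h0_eq_iff (hω : IsRiemannForm (prodPeriod Φ₁ Φ₂) ω)
    {χ : (ι₁ ⊕ ι₂ → ℤ) → ℂ} (hχ : IsSemicharacter (prodPeriod Φ₁ Φ₂) ω χ)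
    {χ₁ : (ι₁ → ℤ) → ℂ} (hχ₁ : IsSemicharacter Φ₁ (pullbackForm (ContinuousLinearMap.inl ℂ E₁ E₂) ω) χ₁)
    {χ₂ : (ι₂ → ℤ) → ℂ} (hχ₂ : IsSemicharacter Φ₂ (pullbackForm (ContinuousLinearMap.inr ℂ E₁ E₂) ω) χ₂) :
    (lineBundleAH hω.isNSForm hχ).h0 =
      (lineBundleAH hω.pullbackForm_inl.isNSForm hχ₁).h0 * (lineBundleAH hω.pullbackForm_inr.isNSForm hχ₂).h0 ↔
      ω = prodForm (pullbackForm (ContinuousLinearMap.inl ℂ E₁ E₂) ω)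
        (pullbackForm (ContinuousLinearMap.inr ℂ E₁ E₂) ω) := by
  rw [← debarre1996_theoreme_3_prod_eq_iff_prodForm hω, ← natCast_sq_eq_sq_iff]
  push_cast
  rw [mul_pow, hω.sq_h0_lineBundleAH_eq_polarizationDegree hχ,
    hω.pullbackForm_inl.sq_h0_lineBundleAH_eq_polarizationDegree hχ₁,
    hω.pullbackForm_inr.sq_h0_lineBundleAH_eq_polarizationDegree hχ₂]

end Theoreme3

end ComplexTorus

end Literature.Geometry.Kaehler

end
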